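import Summits.BirchSwinnertonDyer.Rank1Residual.X4.KuriharaDerivativeLeadingTerm
import Summits.BirchSwinnertonDyer.Rank1Residual.X4.KuriharaBlockSolve
import Literature.NumberTheory.Sieve.PolymathLcmSumsEuler
import HarnessLib

/-!
# Lemma S, part 3/3: the map `γ ↦ (Φ_{P(m)}^{(m)}(d_W γ))_{(W,m)}` on periodic functions is ONTO (cell `b2b-bsdres`, seat additive-p4 gen 31, line V51′/V52-A)

HONEST FRAMING (verbatim, cell `b2b-bsdres`): the goal of the cell is to DELETE the COMBINATION-SHAPED
residual classes for ALL analytic-rank `≤ 1` curves over `ℚ` — "full BSD formula for every rank `≤ 1`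
curve in class `C`" assembled STRICTLY from published theorems — so that the rank-`≤ 1` remainder
becomes exactly the CONSTRUCTION-SHAPED classes, which are TYPED (missing-input Props), NOT attempted;
this is not "finishing BSD". This file: a research-route KERNEL LEMMA file (pure algebra over an arbitrary
commutative ring; no named fact, no conjecture, nothing booked; X4 stays CONSTRUCTION-SHAPED).

## What is proved

**LEMMA S** (`exists_periodic_phi_derivFamily_eq`, the hypothesis `G/hDG/hS` of gen 30's
`kuriharaSum_twoPrime_eq_zero_of_tauSystem`): let `Q` be a finite set of primes and `ψ_q` additive
characters of `(ℤ/q)ˣ` each taking the value `1` at some unit (`q ∈ Q`; true for a surjective discrete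
logarithm). For EVERY target `t(W, m)` on the pairs (`W ⊆ Q`, `m` square-free with prime factors in
`Q ∖ W`) there is a periodic `γ : ℚ → R` with `Φ_{P(m)}^{(m)}(d_W γ) = t(W, m)` for all pairs, where
`d_W = ∏_{q∈W}(H_q − 2)` is the iterated Hecke derivative (`derivFamily`).

Proof (parts 1–2 supply the pieces): index the pairs by `(W, M)` (`M = P(m)`, `m = ∏ M`); the test
function `γ_π = γ_{D,g}` of a pair `π = (W₀, M₀)` — `D = ∏(W₀ ∪ M₀)`, `g` from the diagonal block
(`exists_blockSolve`) with `∑_x g(x) W_M(x) = [M = M₀]` — has `Φ`-vector `e_π +` (entries at pairs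
`σ` with `W₀ ∪ M₀ ⊊ W_σ ∪ M_σ`) by the support/diagonal lemmas of part 1; the unitriangular solve of
part 2 (rank `|W ∪ M|`) finishes.

## References

* B. Mazur, J. Tate, J. Teitelbaum, Invent. Math. 84 (1986), §I.4 (4.2). [cite: MazurTateTeitelbaum1986Invent, §I.4 (4.2)]
* M. Kurihara, Contrib. Math. Comput. Sci. 7 (2014) 317–356, §1.1 (1)–(2). [cite: Kurihara2014, §1.1]
-/

noncomputable section

open scoped MatrixGroups ModularForm

open CongruenceSubgroup Finset

open Literature.NumberTheory.EllipticCurves Literature.NumberTheory.EllipticCurves.ModularForms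

namespace Summit.BirchSwinnertonDyer.Rank1Residual.LevelLowering

variable {R : Type*} [CommRing R] (ψ : (ℓ : ℕ) → (ZMod ℓ)ˣ →* Multiplicative R)

/-! ### §1 Products of finite sets of primes (square-freeness: `Literature.NumberTheory.Sieve.LcmEuler.squarefree_prod_of_primes`) -/

section PrimeSets

/-- A product of distinct primes is non-zero. [folklore] -/
theorem prod_primes_ne_zero {s : Finset ℕ} (hs : ∀ q ∈ s, q.Prime) : ∏ q ∈ s, q ≠ 0 :=
  Finset.prod_ne_zero_iff.mpr fun q hq ↦ (hs q hq).ne_zero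

/-- A prime outside `s` does not divide `∏ s`. [folklore] -/
theorem not_dvd_prod_primes {s : Finset ℕ} (hs : ∀ q ∈ s, q.Prime) {q : ℕ} (hq : q.Prime)
    (hqs : q ∉ s) : ¬ q ∣ ∏ x ∈ s, x := by
  intro h
  have hmem : q ∈ (∏ x ∈ s, x).primeFactors :=
    Nat.mem_primeFactors.mpr ⟨hq, h, prod_primes_ne_zero hs⟩
  rw [Nat.primeFactors_prod hs] at hmem
  exact hqs hmem

/-- Divisibility of products of sets of primes is inclusion. [folklore] -/
theorem subset_of_prod_primes_dvd {s t : Finset ℕ} (hs : ∀ q ∈ s, q.Prime) (ht : ∀ q ∈ t, q.Prime)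
    (h : ∏ q ∈ s, q ∣ ∏ q ∈ t, q) : s ⊆ t := by
  have := Nat.primeFactors_mono h (prod_primes_ne_zero ht)
  rwa [Nat.primeFactors_prod hs, Nat.primeFactors_prod ht] at this

/-- Equality of products of sets of primes is equality of the sets. [folklore] -/
theorem eq_of_prod_primes_eq {s t : Finset ℕ} (hs : ∀ q ∈ s, q.Prime) (ht : ∀ q ∈ t, q.Prime)
    (h : ∏ q ∈ s, q = ∏ q ∈ t, q) : s = t := by
  rw [← Nat.primeFactors_prod hs, h, Nat.primeFactors_prod ht]

end PrimeSets

/-! ### §2 Linearity of `γ ↦ Φ(d_W γ)` -/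

section Linear

/-- `d_U 0 = 0`. [folklore] -/
theorem derivFamily_zero (U : Finset ℕ) : derivFamily (fun _ : ℚ ↦ (0 : R)) U = fun _ ↦ 0 := by
  have h : (fun _ : ℚ ↦ (0 : R)) = fun x ↦ (0 : R) * (fun _ : ℚ ↦ (0 : R)) x := by
    funext x; simp
  rw [h, derivFamily_const_mul]
  funext x
  simp

/-- A scalar multiple of a periodic function is periodic. [folklore] -/
theorem IsPeriodic.const_mul {γ : ℚ → R} (hγ : IsPeriodic γ) (c : R) :
    IsPeriodic (fun x ↦ c * γ x) :=
  fun r z ↦ by simp only [hγ r z]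

end Linear

/-! ### §3 Lemma S on the pairs `(W, M)` -/

section Pairs

/-- **LEMMA S on pairs of sets.** For `Q` a finite set of primes and `ψ_q` hitting `1` at each `q ∈ Q`:
every target `w` on the pairs `(W, M)` of disjoint subsets of `Q` is realised as
`w(W, M) = Φ_M^{(∏M)}(d_W γ)` by ONE periodic `γ`. (Unitriangular solve over the pairs, rank `|W ∪ M|`,
with the test functions `γ_{∏(W∪M), g}`, `g` from the diagonal block.) [cite: Kurihara2014, §1.1 (1)–(2)] -/
theorem exists_periodic_phiTot_derivFamily_pairs (Q : Finset ℕ) (hQ : ∀ q ∈ Q, q.Prime)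
    (hψ : ∀ q ∈ Q, ∃ u : (ZMod q)ˣ, ψ q u = Multiplicative.ofAdd 1)
    (w : Finset ℕ × Finset ℕ → R) :
    ∃ γ : ℚ → R, IsPeriodic γ ∧ ∀ W ⊆ Q, ∀ M ⊆ Q, Disjoint W M →
      PhiTot ψ (derivFamily γ W) (∏ q ∈ M, q) M = w (W, M) := by
  classical
  -- the index type of admissible pairs and the set `S` of realisable vectors
  let prs : Finset (Finset ℕ × Finset ℕ) :=
    (Q.powerset ×ˢ Q.powerset).filter fun π ↦ Disjoint π.1 π.2
  have hprs : ∀ σ : ↥prs, (σ.1.1 ⊆ Q ∧ σ.1.2 ⊆ Q) ∧ Disjoint σ.1.1 σ.1.2 := by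
    intro σ
    have h := Finset.mem_filter.mp σ.2
    exact ⟨⟨Finset.mem_powerset.mp (Finset.mem_product.mp h.1).1,
      Finset.mem_powerset.mp (Finset.mem_product.mp h.1).2⟩, h.2⟩
  let L : (ℚ → R) → ↥prs → R := fun γ σ ↦ PhiTot ψ (derivFamily γ σ.1.1) (∏ q ∈ σ.1.2, q) σ.1.2
  let S : (↥prs → R) → Prop := fun v ↦ ∃ γ : ℚ → R, IsPeriodic γ ∧ ∀ σ, L γ σ = v σ
  have h0 : S 0 := ⟨fun _ ↦ 0, isPeriodic_zero, fun σ ↦ by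
    simp only [L, derivFamily_zero, PhiTot_zero_fun, Pi.zero_apply]⟩
  have hadd : ∀ v v', S v → S v' → S (v + v') := by
    rintro v v' ⟨γ, hγ, hL⟩ ⟨γ', hγ', hL'⟩
    refine ⟨fun x ↦ γ x + γ' x, hγ.add hγ', fun σ ↦ ?_⟩
    simp only [L, derivFamily_add, PhiTot_add, Pi.add_apply, ← hL σ, ← hL' σ]
  have hsmul : ∀ (a : R) (v : ↥prs → R), S v → S (a • v) := by
    rintro a v ⟨γ, hγ, hL⟩
    refine ⟨fun x ↦ a * γ x, hγ.const_mul a, fun σ ↦ ?_⟩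
    simp only [L, derivFamily_const_mul, PhiTot_const_mul, Pi.smul_apply, smul_eq_mul, ← hL σ]
  -- primality bookkeeping for a pair
  have hWp : ∀ σ : ↥prs, ∀ q ∈ σ.1.1, q.Prime := fun σ q hq ↦ hQ q ((hprs σ).1.1 hq)
  have hMp : ∀ σ : ↥prs, ∀ q ∈ σ.1.2, q.Prime := fun σ q hq ↦ hQ q ((hprs σ).1.2 hq)
  have hUp : ∀ σ : ↥prs, ∀ q ∈ σ.1.1 ∪ σ.1.2, q.Prime := by
    intro σ q hq
    rcases Finset.mem_union.mp hq with h | h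
    exacts [hWp σ q h, hMp σ q h]
  have hWm : ∀ σ : ↥prs, ∀ q ∈ σ.1.1, ¬ q ∣ ∏ x ∈ σ.1.2, x := fun σ q hq ↦
    not_dvd_prod_primes (hMp σ) (hWp σ q hq) (Finset.disjoint_left.mp (hprs σ).2 hq)
  have hMm : ∀ σ : ↥prs, ∀ i ∈ σ.1.2, i ∣ ∏ x ∈ σ.1.2, x := fun σ i hi ↦
    Finset.dvd_prod_of_mem _ hi
  have hlevel : ∀ σ : ↥prs, (∏ x ∈ σ.1.2, x) * ∏ x ∈ σ.1.1, x = ∏ x ∈ σ.1.1 ∪ σ.1.2, x := by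
    intro σ
    rw [Finset.prod_union (hprs σ).2, mul_comm]
  -- the generators: test functions of the pairs
  have hgen : ∀ π : ↥prs, ∃ v, S v ∧ v π = 1 ∧
      ∀ σ, σ ≠ π → v σ ≠ 0 → (π.1.1 ∪ π.1.2).card < (σ.1.1 ∪ σ.1.2).card := by
    intro π
    -- the level `D = ∏ (W₀ ∪ M₀)` and the block solution `g`
    have hDsq : Squarefree (∏ x ∈ π.1.1 ∪ π.1.2, x) :=
      Literature.NumberTheory.Sieve.LcmEuler.squarefree_prod_of_primes (hUp π)
    haveI hD0 : NeZero (∏ x ∈ π.1.1 ∪ π.1.2, x) := ⟨prod_primes_ne_zero (hUp π)⟩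
    have hPD : (∏ x ∈ π.1.1 ∪ π.1.2, x).primeFactors = π.1.1 ∪ π.1.2 :=
      Nat.primeFactors_prod (hUp π)
    have hψD : ∀ q ∈ (∏ x ∈ π.1.1 ∪ π.1.2, x).primeFactors,
        ∃ u : (ZMod q)ˣ, ψ q u = Multiplicative.ofAdd 1 := by
      intro q hq
      rw [hPD] at hq
      rcases Finset.mem_union.mp hq with h | h
      exacts [hψ q ((hprs π).1.1 h), hψ q ((hprs π).1.2 h)]
    obtain ⟨g, hg⟩ := exists_blockSolve hDsq ψ hψD fun M ↦ if M = π.1.2 then (1 : R) else 0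
    refine ⟨L (unitPointFun (∏ x ∈ π.1.1 ∪ π.1.2, x) g), ⟨_, isPeriodic_unitPointFun _ g,
      fun σ ↦ rfl⟩, ?_, ?_⟩
    · -- the diagonal entry is `1`
      haveI : NeZero (∏ x ∈ π.1.2, x) := ⟨prod_primes_ne_zero (hMp π)⟩
      show PhiTot ψ (derivFamily (unitPointFun (∏ x ∈ π.1.1 ∪ π.1.2, x) g) π.1.1)
        (∏ q ∈ π.1.2, q) π.1.2 = 1
      rw [PhiTot_derivFamily_unitPointFun_diag ψ _ g (hWp π) _ (hWm π) (hMm π) (hlevel π).symm,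
        hg π.1.2 (by rw [hPD]; exact Finset.subset_union_right), if_pos rfl]
    · -- off-diagonal non-zero entries sit at strictly larger pairs
      intro σ hne hv
      haveI : NeZero (∏ x ∈ σ.1.2, x) := ⟨prod_primes_ne_zero (hMp σ)⟩
      have hv' : PhiTot ψ (derivFamily (unitPointFun (∏ x ∈ π.1.1 ∪ π.1.2, x) g) σ.1.1)
          (∏ q ∈ σ.1.2, q) σ.1.2 ≠ 0 := hv
      -- support: `D ∣ ∏ (W_σ ∪ M_σ)`
      have hdvd : ∏ x ∈ π.1.1 ∪ π.1.2, x ∣ ∏ x ∈ σ.1.1 ∪ σ.1.2, x := by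
        by_contra h
        rw [← hlevel σ] at h
        exact hv' (PhiTot_derivFamily_unitPointFun_eq_zero ψ _ g (hWp σ) _ (hWm σ) (hMm σ) h)
      have hsub : π.1.1 ∪ π.1.2 ⊆ σ.1.1 ∪ σ.1.2 := subset_of_prod_primes_dvd (hUp π) (hUp σ) hdvd
      refine Finset.card_lt_card (Finset.ssubset_iff_subset_ne.mpr ⟨hsub, fun heq ↦ ?_⟩)
      -- equal supports: the diagonal lemma at `σ` gives `[M_σ = M₀]`, forcing `σ = π`
      have hlev : ∏ x ∈ π.1.1 ∪ π.1.2, x = (∏ x ∈ σ.1.2, x) * ∏ x ∈ σ.1.1, x := by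
        rw [hlevel σ, heq]
      have hMσ : σ.1.2 ⊆ (∏ x ∈ π.1.1 ∪ π.1.2, x).primeFactors := by
        rw [hPD, heq]
        exact Finset.subset_union_right
      rw [PhiTot_derivFamily_unitPointFun_diag ψ _ g (hWp σ) _ (hWm σ) (hMm σ) hlev,
        hg σ.1.2 hMσ] at hv'
      have hM : σ.1.2 = π.1.2 := by
        by_contra h
        exact hv' (if_neg h)
      have hW : σ.1.1 = π.1.1 := by
        have h1 : σ.1.1 = (σ.1.1 ∪ σ.1.2) \ σ.1.2 := (Finset.union_sdiff_cancel_right (hprs σ).2).symm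
        have h2 : π.1.1 = (π.1.1 ∪ π.1.2) \ π.1.2 := (Finset.union_sdiff_cancel_right (hprs π).2).symm
        rw [h1, h2, ← heq, hM]
      exact hne (Subtype.ext (Prod.ext hW hM))
  have hall := forall_of_unitriangular (fun σ : ↥prs ↦ (σ.1.1 ∪ σ.1.2).card) S h0 hadd hsmul hgen
  obtain ⟨γ, hγ, hL⟩ := hall fun σ ↦ w σ.1
  refine ⟨γ, hγ, fun W hW M hM hdisj ↦ ?_⟩
  have hmem : (W, M) ∈ prs :=
    Finset.mem_filter.mpr ⟨Finset.mem_product.mpr ⟨Finset.mem_powerset.mpr hW,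
      Finset.mem_powerset.mpr hM⟩, hdisj⟩
  exact hL ⟨(W, M), hmem⟩

end Pairs

/-! ### §4 Lemma S -/

section LemmaS

/-- **LEMMA S (surjectivity).** Let `Q` be a finite set of primes and `ψ_q : (ℤ/q)ˣ → R` additive
characters each taking the value `1` at some unit (`q ∈ Q`). For every target `t`, there is a
periodic `γ : ℚ → R` whose iterated Hecke derivatives `d_W γ = ∏_{q∈W}(H_q − 2) γ` (`W ⊆ Q`) have
prescribed Kurihara sums `Φ_{P(m)}^{(m)}(d_W γ) = t(W, m)` at every square-free level `m` with prime
factors in `Q` disjoint from `W`. This discharges the hypothesis `G/hDG/hS` of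
`kuriharaSum_twoPrime_eq_zero_of_tauSystem` (`X4/KuriharaAdditiveLevelLowering.lean`).
[cite: Kurihara2014, §1.1 (1)–(2)] [cite: MazurTateTeitelbaum1986Invent, §I.4 (4.2)] -/
theorem exists_periodic_phi_derivFamily_eq (Q : Finset ℕ) (hQ : ∀ q ∈ Q, q.Prime)
    (hψ : ∀ q ∈ Q, ∃ u : (ZMod q)ˣ, ψ q u = Multiplicative.ofAdd 1)
    (t : Finset ℕ → ℕ → R) :
    ∃ γ : ℚ → R, IsPeriodic γ ∧ ∀ W ⊆ Q, ∀ (m : ℕ) [NeZero m], Squarefree m →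
      m.primeFactors ⊆ Q → Disjoint W m.primeFactors →
      Phi ψ (derivFamily γ W) m m.primeFactors = t W m := by
  obtain ⟨γ, hγ, h⟩ := exists_periodic_phiTot_derivFamily_pairs ψ Q hQ hψ
    fun π ↦ t π.1 (∏ q ∈ π.2, q)
  refine ⟨γ, hγ, fun W hW m _ hm hmQ hdisj ↦ ?_⟩
  have key := h W hW m.primeFactors hmQ hdisj
  simp only [Nat.prod_primeFactors_of_squarefree hm] at key
  rw [← PhiTot_eq_Phi]
  exact key

end LemmaS

end Summit.BirchSwinnertonDyer.Rank1Residual.LevelLowering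

end
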